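import Mathlib
import HarnessLib
import Summits.NavierStokesRegularity.NavierStokesRegularity.Theorems.PoloidalWindowDoorPoloidalWindowRigiditySparseEnergyScaledEnergy
import Summits.NavierStokesRegularity.NavierStokesRegularity.Theorems.PoloidalWindowDoorPoloidalWindowRigiditySparseEnergyTimeWeights

/-!
# Route `PoloidalWindowDoor`, crux `PoloidalWindowRigidity` (stmt-19708), line `sparse_energy` — A CONSEQUENCE OF S1:
# THE SCALED CUBIC NORM OF A TYPE-I PROFILE IS BOUNDED AT EVERY PARABOLIC CYLINDER, UP TO THE APEX

Seat ns-poloidal-K2-p2 g10 (LEAD-lineage on 19708; file `--supports`).  With S1 (`…SparseEnergyScaledEnergy.stub_scaledEnergy`: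
`∫⁻_{B_R(a)} |v(t)|² ≤ K·R`) and the Type-I bound `|v(t)| ≤ C/√(−t)`, the cubic CKN quantity of a profile of the Type-I class is
scale-invariantly bounded:

* `scaledCubic_window` — `∫⁻_{s<t<t₁} ∫⁻_{B_R(a)} |v|³ ≤ 2CK · R · (√(−s) − √(−t₁))` for `s < t₁ < 0`;
* `scaledCubic` — `∫⁻_{t₀−R² < t < t₀} ∫⁻_{B_R(a)} |v|³ ≤ 2CK · R²` for EVERY `t₀ ≤ 0`, centre `a`, radius `R > 0` — including the cylinders
  `Q_R(a, 0)` that reach the apex time (`setLIntegral_iUnion_of_directed`, no measurability needed).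

Together with S1 this says: every profile of the class has bounded scaled energy `A`, dissipation `E` and cubic norm `C ≤ 2CK` at all scales and
centres (the «Type I in scaled energy» regime of the ε-regularity theory; consumed e.g. by ns-idea-8's `period_door` squeeze).

WHAT THIS IS NOT: not a claim about Navier–Stokes regularity; an a-priori estimate for hypothetical Type-I ancient profiles (bears_on LADDER-NS N0
via crux 19708, line sparse_energy). [folklore]
-/

noncomputable section

-- the summit and its single sub-problem share the name (CONVENTIONS §1), as in every Theorems file
set_option linter.dupNamespace false

namespace Summit.NavierStokesRegularity.NavierStokesRegularity.Theorems.PoloidalWindowDoorPoloidalWindowRigiditySparseEnergyScaledCubic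

open MeasureTheory Set Function Filter Topology Metric intervalIntegral
open scoped ENNReal
open Literature.Analysis Literature.Analysis.FluidPDE
open Summit.NavierStokesRegularity.NavierStokesRegularity.Theorems.PoloidalWindowDoorPoloidalWindowRigiditySparseEnergyScaledEnergy
open Summit.NavierStokesRegularity.NavierStokesRegularity.Theorems.PoloidalWindowDoorPoloidalWindowRigiditySparseEnergyTimeWeights

variable {C : ℝ} {v : ℝ → EuclideanSpace ℝ (Fin 3) → EuclideanSpace ℝ (Fin 3)}

/-- `∫_s^{t₁} dt/√(−t) = 2(√(−s) − √(−t₁))` for `s < t₁ < 0`. [folklore] -/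
theorem integral_inv_sqrt_neg_eq {s t₁ : ℝ} (hst : s < t₁) (ht₁ : t₁ < 0) :
    ∫ t in s..t₁, 1 / Real.sqrt (-t) = 2 * (Real.sqrt (-s) - Real.sqrt (-t₁)) := by
  have hderiv : ∀ t ∈ uIcc s t₁, HasDerivAt (fun τ : ℝ => -2 * Real.sqrt (-τ)) (1 / Real.sqrt (-t)) t := by
    intro t ht; rw [uIcc_of_le hst.le] at ht; exact hasDerivAt_neg_two_sqrt_neg (lt_of_le_of_lt ht.2 ht₁)
  have hcont : ContinuousOn (fun t : ℝ => 1 / Real.sqrt (-t)) (uIcc s t₁) := by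
    rw [uIcc_of_le hst.le]
    refine continuousOn_const.div (continuousOn_id.neg.sqrt) fun t ht => ?_
    exact (Real.sqrt_pos.2 (neg_pos.2 (lt_of_le_of_lt ht.2 ht₁))).ne'
  rw [integral_eq_sub_of_hasDerivAt hderiv hcont.intervalIntegrable]
  ring

/-- `√(R² + u) − √u ≤ R` for `u ≥ 0`, `R ≥ 0`. [folklore] -/
theorem sqrt_sq_add_sub_sqrt_le {R u : ℝ} (hR : 0 ≤ R) (hu : 0 ≤ u) : Real.sqrt (R ^ 2 + u) - Real.sqrt u ≤ R := by
  have h1 : Real.sqrt (R ^ 2 + u) ≤ R + Real.sqrt u := by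
    rw [Real.sqrt_le_left (by positivity)]
    nlinarith [Real.sq_sqrt hu, Real.sqrt_nonneg u]
  linarith

/-- **The scaled cubic norm on a window strictly before the apex.**  For a profile of the Type-I class (with the scale-invariant energy
bound `K` of S1), `s < t₁ < 0`, a centre `a` and `R > 0`:
`∫⁻_{s<t<t₁} ∫⁻_{B_R(a)} |v(t,x)|³ dx dt ≤ 2·C·K·R·(√(−s) − √(−t₁))`. [folklore] -/
theorem scaledCubic_window (hrate : HasTypeITimeDecay C v) {K : ℝ} (hK0 : 0 ≤ K)
    (hK : ∀ t₀ < 0, ∀ (a : EuclideanSpace ℝ (Fin 3)) (R : ℝ), 0 < R →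
      (∫⁻ x in ball a R, ENNReal.ofReal (‖v t₀ x‖ ^ 2)) ≤ ENNReal.ofReal (K * R))
    {s t₁ : ℝ} (hst : s < t₁) (ht₁ : t₁ < 0) (a : EuclideanSpace ℝ (Fin 3)) {R : ℝ} (hR : 0 < R) :
    (∫⁻ t in Ioo s t₁, ∫⁻ x in ball a R, ENNReal.ofReal (‖v t x‖ ^ 3)) ≤
      ENNReal.ofReal (2 * C * K * R * (Real.sqrt (-s) - Real.sqrt (-t₁))) := by
  have hC0 : 0 ≤ C := by
    have h := hrate (-1) (by norm_num) 0
    rw [neg_neg, Real.sqrt_one, div_one] at h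
    exact (norm_nonneg _).trans h
  -- the slice bound: `∫⁻_{B_R} |v(t)|³ ≤ (C/√(−t))·K·R`
  have hslice : ∀ t < 0, (∫⁻ x in ball a R, ENNReal.ofReal (‖v t x‖ ^ 3)) ≤ ENNReal.ofReal (C * K * R / Real.sqrt (-t)) := by
    intro t ht
    have hnt : 0 < -t := neg_pos.2 ht
    have hsq : 0 < Real.sqrt (-t) := Real.sqrt_pos.2 hnt
    have hM : 0 ≤ C / Real.sqrt (-t) := div_nonneg hC0 hsq.le
    have hpt : ∀ x, ENNReal.ofReal (‖v t x‖ ^ 3) ≤ ENNReal.ofReal (C / Real.sqrt (-t)) * ENNReal.ofReal (‖v t x‖ ^ 2) := by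
      intro x
      rw [← ENNReal.ofReal_mul hM]
      refine ENNReal.ofReal_le_ofReal ?_
      have h1 : ‖v t x‖ ≤ C / Real.sqrt (-t) := hrate t ht x
      have h2 : 0 ≤ ‖v t x‖ := norm_nonneg _
      nlinarith [mul_le_mul_of_nonneg_right h1 (sq_nonneg ‖v t x‖)]
    calc (∫⁻ x in ball a R, ENNReal.ofReal (‖v t x‖ ^ 3))
        ≤ ∫⁻ x in ball a R, ENNReal.ofReal (C / Real.sqrt (-t)) * ENNReal.ofReal (‖v t x‖ ^ 2) := lintegral_mono hpt
      _ = ENNReal.ofReal (C / Real.sqrt (-t)) * ∫⁻ x in ball a R, ENNReal.ofReal (‖v t x‖ ^ 2) :=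
          lintegral_const_mul' _ _ ENNReal.ofReal_ne_top
      _ ≤ ENNReal.ofReal (C / Real.sqrt (-t)) * ENNReal.ofReal (K * R) := by gcongr; exact hK t ht a R hR
      _ = ENNReal.ofReal (C * K * R / Real.sqrt (-t)) := by
          rw [← ENNReal.ofReal_mul hM]
          congr 1
          field_simp
  -- integrate the majorant in time
  have hcont : ContinuousOn (fun t : ℝ => C * K * R / Real.sqrt (-t)) (Icc s t₁) := by
    refine continuousOn_const.div (continuousOn_id.neg.sqrt) fun t ht => ?_
    exact (Real.sqrt_pos.2 (neg_pos.2 (lt_of_le_of_lt ht.2 ht₁))).ne'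
  have hint : IntegrableOn (fun t : ℝ => C * K * R / Real.sqrt (-t)) (Ioo s t₁) :=
    (hcont.integrableOn_compact isCompact_Icc).mono_set Ioo_subset_Icc_self
  have hnn : ∀ t ∈ Ioo s t₁, 0 ≤ C * K * R / Real.sqrt (-t) := fun t ht =>
    div_nonneg (by positivity) (Real.sqrt_nonneg _)
  calc (∫⁻ t in Ioo s t₁, ∫⁻ x in ball a R, ENNReal.ofReal (‖v t x‖ ^ 3))
      ≤ ∫⁻ t in Ioo s t₁, ENNReal.ofReal (C * K * R / Real.sqrt (-t)) :=
        setLIntegral_mono' measurableSet_Ioo fun t ht => hslice t (ht.2.trans ht₁)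
    _ = ENNReal.ofReal (∫ t in Ioo s t₁, C * K * R / Real.sqrt (-t)) := by
        rw [ofReal_integral_eq_lintegral_ofReal hint ((ae_restrict_iff' measurableSet_Ioo).2 (Eventually.of_forall hnn))]
    _ = ENNReal.ofReal (2 * C * K * R * (Real.sqrt (-s) - Real.sqrt (-t₁))) := by
        congr 1
        rw [← integral_Ioc_eq_integral_Ioo, ← intervalIntegral.integral_of_le hst.le]
        have e : (fun t : ℝ => C * K * R / Real.sqrt (-t)) = fun t => (C * K * R) * (1 / Real.sqrt (-t)) := by
          funext t; ring
        rw [e, intervalIntegral.integral_const_mul, integral_inv_sqrt_neg_eq hst ht₁]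
        ring

/-- **THE SCALED CUBIC NORM IS BOUNDED AT EVERY PARABOLIC CYLINDER, UP TO THE APEX.**  For a profile of the route's Type-I class there is
`K₃ ≥ 0` (namely `2·C·K`, `K` the scale-invariant energy bound of S1) with, for every `t₀ ≤ 0`, every centre `a` and every `R > 0`:
`∫⁻_{t₀−R²<t<t₀} ∫⁻_{B_R(a)} |v(t,x)|³ dx dt ≤ K₃·R²` — the CKN cubic quantity `C(R) ≤ K₃` at ALL scales, centres and apex times `t₀ ≤ 0`
(the cylinders reaching the apex time `t₀ = 0` by monotone convergence in the time window). [folklore] -/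
theorem scaledCubic (hrate : HasTypeITimeDecay C v)
    (hcont : ContinuousOn (uncurry v) (Iio (0 : ℝ) ×ˢ univ))
    (hmild : ∀ s t : ℝ, s < t → t < 0 → ∀ x,
      v t x = UnboundedOperators.heatExtension (v s) (t - s) x - oseenDuhamel 1 s v v t x)
    (hdiv : ∀ t < 0, VectorCalculus.IsDivFree (v t)) :
    ∃ K₃ : ℝ, 0 ≤ K₃ ∧ ∀ t₀ : ℝ, t₀ ≤ 0 → ∀ (a : EuclideanSpace ℝ (Fin 3)) (R : ℝ), 0 < R →
      (∫⁻ t in Ioo (t₀ - R ^ 2) t₀, ∫⁻ x in ball a R, ENNReal.ofReal (‖v t x‖ ^ 3)) ≤ ENNReal.ofReal (K₃ * R ^ 2) := by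
  have hC0 : 0 ≤ C := by
    have h := hrate (-1) (by norm_num) 0
    rw [neg_neg, Real.sqrt_one, div_one] at h
    exact (norm_nonneg _).trans h
  obtain ⟨K, hK0, hK⟩ := scaledEnergy hrate hcont hmild hdiv
  have hKe : ∀ t₀ < 0, ∀ (a : EuclideanSpace ℝ (Fin 3)) (R : ℝ), 0 < R →
      (∫⁻ x in ball a R, ENNReal.ofReal (‖v t₀ x‖ ^ 2)) ≤ ENNReal.ofReal (K * R) := fun t₀ ht₀ a R hR => (hK t₀ ht₀ a R hR).1
  refine ⟨2 * C * K, by positivity, fun t₀ ht₀ a R hR => ?_⟩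
  -- the bound on any window `(t₀ − R², t₁)` with `t₁ < 0`, `t₁ ≤ t₀`
  have hwin : ∀ t₁ : ℝ, t₁ < 0 → t₁ ≤ t₀ →
      (∫⁻ t in Ioo (t₀ - R ^ 2) t₁, ∫⁻ x in ball a R, ENNReal.ofReal (‖v t x‖ ^ 3)) ≤ ENNReal.ofReal (2 * C * K * R ^ 2) := by
    intro t₁ ht₁ ht₁₀
    rcases le_or_gt t₁ (t₀ - R ^ 2) with hle | hlt
    · rw [Ioo_eq_empty_of_le hle, Measure.restrict_empty, lintegral_zero_measure]
      exact bot_le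
    · refine (scaledCubic_window hrate hK0 hKe hlt ht₁ a hR).trans (ENNReal.ofReal_le_ofReal ?_)
      have h1 : Real.sqrt (-(t₀ - R ^ 2)) - Real.sqrt (-t₁) ≤ R := by
        have h2 : Real.sqrt (-t₀) ≤ Real.sqrt (-t₁) := Real.sqrt_le_sqrt (by linarith)
        have h3 := sqrt_sq_add_sub_sqrt_le hR.le (neg_nonneg.2 ht₀)
        rw [show -(t₀ - R ^ 2) = R ^ 2 + -t₀ by ring]
        linarith
      have h4 : 0 ≤ 2 * C * K * R := by positivity
      nlinarith [mul_le_mul_of_nonneg_left h1 h4]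
  rcases lt_or_eq_of_le ht₀ with hlt | heq
  · exact hwin t₀ hlt le_rfl
  · -- the apex: exhaust `(−R², 0)` by the windows `(−R², −1/(n+1))`
    subst heq
    have hU : Ioo (0 - R ^ 2) (0 : ℝ) = ⋃ n : ℕ, Ioo (0 - R ^ 2) (-((n : ℝ) + 1)⁻¹) := by
      ext t
      simp only [mem_iUnion, mem_Ioo]
      constructor
      · rintro ⟨h1, h2⟩
        obtain ⟨n, hn⟩ := exists_nat_gt (1 / (-t))
        have hnt : 0 < -t := neg_pos.2 h2
        refine ⟨n, h1, ?_⟩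
        have hn1 : 1 / (-t) < (n : ℝ) + 1 := by linarith
        rw [div_lt_iff₀ hnt] at hn1
        have : ((n : ℝ) + 1)⁻¹ < -t := by
          rw [inv_lt_comm₀ (by positivity) hnt, inv_eq_one_div]
          have := (div_lt_iff₀ hnt).2 (by linarith : 1 < ((n : ℝ) + 1) * -t)
          exact this
        linarith
      · rintro ⟨n, h1, h2⟩
        exact ⟨h1, h2.trans (by rw [neg_lt_zero]; positivity)⟩
    have hdir : Directed (· ⊆ ·) fun n : ℕ => Ioo (0 - R ^ 2) (-((n : ℝ) + 1)⁻¹) := by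
      refine Monotone.directed_le fun m n hmn => Ioo_subset_Ioo_right ?_
      have : ((n : ℝ) + 1)⁻¹ ≤ ((m : ℝ) + 1)⁻¹ := by
        apply inv_anti₀ (by positivity)
        exact_mod_cast Nat.succ_le_succ hmn
      linarith
    rw [hU, setLIntegral_iUnion_of_directed _ hdir]
    exact iSup_le fun n => hwin _ (by rw [neg_lt_zero]; positivity) (by rw [neg_nonpos]; positivity)

end Summit.NavierStokesRegularity.NavierStokesRegularity.Theorems.PoloidalWindowDoorPoloidalWindowRigiditySparseEnergyScaledCubic

end
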